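import Literature.Geometry.Kaehler.LocalFormsGlue
import HarnessLib

/-!
# The Mayer–Vietoris connecting homomorphism for local de Rham cohomology

Support for the finite-dimensionality of de Rham cohomology
(`Literature.AlgebraicGeometry.Motives.finite_deRhamCohomology`), on top of
`Literature.Geometry.Kaehler.LocalForms` / `LocalFormsGlue`.

For open sets `P`, `Q` of a manifold and a bump pair `b : BumpPair I P Q` (`ρ_P + ρ_Q = 1` on
`P ∪ Q`, `ρ_Q ≡ 0` near `P ∖ Q`, `ρ_P ≡ 0` near `Q ∖ P`) we construct the **connecting form**
`b.connect γ` of a closed `k`-form `γ` on `P ∩ Q`: the closed `(k+1)`-form on `P ∪ Q` equal to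
`d(ρ_Q γ)` on `P` and to `-d(ρ_P γ)` on `Q` (Bott–Tu (1982), (2.5); Lee (2013), p. 450), show
that it is linear and sends exact forms to exact forms (`connect_mem_localExactForms`), and hence
descends to the **connecting homomorphism** `LocalDeRham.delta : H^k(P ∩ Q) → H^{k+1}(P ∪ Q)`.
The two halves of the exactness of the Mayer–Vietoris sequence that the finiteness argument uses
are then proved in the following relative form, for open `A ⊇ P`, `B ⊇ Q`:

* `LocalDeRham.exists_delta_eq_res` (**kernel ⊆ image of `δ`, with shrinking**): a class on
  `A ∪ B` that dies on `A` and on `B` restricts, on `P ∪ Q`, to `δ` of (the restriction to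
  `P ∩ Q` of) a class on `A ∩ B`; for `P = A`, `Q = B` this is exactness of
  `H^k(A ∩ B) → H^{k+1}(A ∪ B) → H^{k+1}(A) ⊕ H^{k+1}(B)` at the middle term;
* `LocalDeRham.eq_zero_of_res_eq_zero` (degree `0`): a class on `A ∪ B` that dies on `A` and
  on `B` is zero.

No Leibniz rule is needed: only locality, linearity and `d ∘ d = 0` of the local calculus.

## References

* R. Bott, L. W. Tu, *Differential Forms in Algebraic Topology* (1982), §I.2, Prop. 2.3 and
  (2.5)–(2.7) (the Mayer–Vietoris sequence and its coboundary).
* J. M. Lee, *Introduction to Smooth Manifolds*, 2nd ed. (2013), Thm. 17.20, pp. 449–451.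
-/

noncomputable section

open scoped Manifold ContDiff Topology
open Bundle Set Filter

namespace Literature.Geometry.Kaehler

variable {E : Type*} [NormedAddCommGroup E] [NormedSpace ℝ E]
  {H : Type*} [TopologicalSpace H] {I : ModelWithCorners ℝ E H}
  {M : Type*} [TopologicalSpace M] [ChartedSpace H M]
  {F : Type*} [NormedAddCommGroup F] [NormedSpace ℝ F] {k : ℕ}

/-! ### Pointwise linearity of `d`, continued -/

/-- `d` commutes with negation. [folklore] -/
theorem mextDeriv_neg (α : MForm I M F k) : mextDeriv (-α) = -mextDeriv α := by
  rw [show -α = (-1 : ℝ) • α by simp, mextDeriv_smul]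
  simp

/-- `d` is subtractive at a point at which both forms are smooth. [folklore] -/
theorem mextDeriv_sub_apply {α β : MForm I M F k} {x : M} (hα : α.SmoothAt x) (hβ : β.SmoothAt x) :
    mextDeriv (α - β) x = mextDeriv α x - mextDeriv β x := by
  rw [sub_eq_add_neg, mextDeriv_add_apply hα hβ.neg, mextDeriv_neg, Pi.neg_apply, sub_eq_add_neg]

namespace BumpPair

variable {P Q : Set M} (b : BumpPair I P Q)

/-! ### The two pieces `ρ_Q γ` on `P` and `-ρ_P γ` on `Q` -/

/-- The left piece `(ρ_Q • γ)|_P` of the Mayer–Vietoris splitting of a form `γ` on `P ∩ Q`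
(Bott–Tu (1982), proof of Prop. 2.3). [cite: BottTu1982Forms, Prop. 2.3] -/
def leftPiece (γ : MForm I M F k) : MForm I M F k := (b.ρQ • γ).restr P

/-- The right piece `(-ρ_P • γ)|_Q` of the Mayer–Vietoris splitting of a form `γ` on `P ∩ Q`;
`leftPiece - rightPiece = γ` on `P ∩ Q`. [cite: BottTu1982Forms, Prop. 2.3] -/
def rightPiece (γ : MForm I M F k) : MForm I M F k := (-(b.ρP • γ)).restr Q

/-- The left piece is additive. [folklore] -/
theorem leftPiece_add (γ γ' : MForm I M F k) : b.leftPiece (γ + γ') = b.leftPiece γ + b.leftPiece γ' := by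
  simp [leftPiece, smul_add]

/-- The left piece commutes with scalars. [folklore] -/
theorem leftPiece_smul (c : ℝ) (γ : MForm I M F k) : b.leftPiece (c • γ) = c • b.leftPiece γ := by
  rw [leftPiece, leftPiece, smul_comm, MForm.restr_smul]

/-- The right piece is additive. [folklore] -/
theorem rightPiece_add (γ γ' : MForm I M F k) : b.rightPiece (γ + γ') = b.rightPiece γ + b.rightPiece γ' := by
  rw [rightPiece, rightPiece, rightPiece, smul_add, neg_add, MForm.restr_add]

/-- The right piece commutes with scalars. [folklore] -/
theorem rightPiece_smul (c : ℝ) (γ : MForm I M F k) : b.rightPiece (c • γ) = c • b.rightPiece γ := by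
  rw [rightPiece, rightPiece, smul_comm, ← smul_neg, MForm.restr_smul]

/-- The left piece of a form on `P ∩ Q` is a form on `P`. [cite: BottTu1982Forms, Prop. 2.3] -/
theorem leftPiece_mem (hP : IsOpen P) {γ : MForm I M F k} (hγ : γ ∈ smoothFormsOn I F (P ∩ Q) k) :
    b.leftPiece γ ∈ smoothFormsOn I F P k :=
  b.smul_restr_mem_left hP hγ

/-- The right piece of a form on `P ∩ Q` is a form on `Q`. [cite: BottTu1982Forms, Prop. 2.3] -/
theorem rightPiece_mem (hQ : IsOpen Q) {γ : MForm I M F k} (hγ : γ ∈ smoothFormsOn I F (P ∩ Q) k) :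
    b.rightPiece γ ∈ smoothFormsOn I F Q k := by
  rw [rightPiece, MForm.restr_neg]
  exact neg_mem (b.smul_restr_mem_right hQ hγ)

/-- On `P ∩ Q`, `leftPiece γ - rightPiece γ = γ`. [cite: BottTu1982Forms, Prop. 2.3] -/
theorem leftPiece_sub_rightPiece_apply (γ : MForm I M F k) {x : M} (hx : x ∈ P ∩ Q) :
    b.leftPiece γ x - b.rightPiece γ x = γ x := by
  rw [leftPiece, rightPiece, MForm.restr_apply_of_mem _ hx.1, MForm.restr_apply_of_mem _ hx.2,
    Pi.neg_apply, sub_neg_eq_add]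
  exact b.smul_add_smul_apply (Or.inl hx.1)

/-- For a closed form `γ` on `P ∩ Q`, the exterior derivatives of the two pieces agree on
`P ∩ Q` (their difference is `dγ = 0` there). [cite: BottTu1982Forms, §I.2 (2.5)] -/
theorem mextDeriv_leftPiece_eq (hP : IsOpen P) (hQ : IsOpen Q) {γ : MForm I M F k}
    (hγ : γ ∈ localClosedForms I F k (P ∩ Q)) {x : M} (hx : x ∈ P ∩ Q) :
    mextDeriv (b.leftPiece γ) x = mextDeriv (b.rightPiece γ) x := by
  have hl : (b.leftPiece γ).SmoothAt x := (b.leftPiece_mem hP hγ.1).1 x hx.1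
  have hr : (b.rightPiece γ).SmoothAt x := (b.rightPiece_mem hQ hγ.1).1 x hx.2
  have h : mextDeriv (b.leftPiece γ - b.rightPiece γ) x = mextDeriv γ x := by
    refine mextDeriv_congr_of_eventuallyEq ?_
    filter_upwards [(hP.inter hQ).mem_nhds hx] with y hy
    exact b.leftPiece_sub_rightPiece_apply γ hy
  rw [mextDeriv_sub_apply hl hr, hγ.2 x hx] at h
  exact sub_eq_zero.1 h

/-! ### The connecting form -/

/-- **The Mayer–Vietoris connecting form** of `γ` (a closed `k`-form on `P ∩ Q`): the
`(k+1)`-form on `P ∪ Q` equal to `d(ρ_Q γ)` on `P` and to `-d(ρ_P γ)` on `Q` (they agree on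
`P ∩ Q`), glued. Bott–Tu (1982), (2.5)–(2.7); Lee (2013), p. 450. [cite: BottTu1982Forms, §I.2 (2.5)] -/
def connect (γ : MForm I M F k) : MForm I M F (k + 1) :=
  MForm.glue P Q ((mextDeriv (b.leftPiece γ)).restr P) ((mextDeriv (b.rightPiece γ)).restr Q)

/-- The two candidate pieces of `connect γ` agree on `P ∩ Q` for closed `γ`. [folklore] -/
theorem connect_pieces_agree (hP : IsOpen P) (hQ : IsOpen Q) {γ : MForm I M F k}
    (hγ : γ ∈ localClosedForms I F k (P ∩ Q)) :
    ∀ y ∈ P ∩ Q, (mextDeriv (b.leftPiece γ)).restr P y = (mextDeriv (b.rightPiece γ)).restr Q y := by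
  intro y hy
  rw [MForm.restr_apply_of_mem _ hy.1, MForm.restr_apply_of_mem _ hy.2]
  exact b.mextDeriv_leftPiece_eq hP hQ hγ hy

/-- On `P`, `connect γ = d(leftPiece γ)`. [folklore] -/
theorem connect_apply_of_mem_left (γ : MForm I M F k) {x : M} (hx : x ∈ P) :
    b.connect γ x = mextDeriv (b.leftPiece γ) x := by
  rw [connect, MForm.glue_apply_of_mem_left _ _ hx, MForm.restr_apply_of_mem _ hx]

/-- On `Q`, `connect γ = d(rightPiece γ)` for closed `γ`. [folklore] -/
theorem connect_apply_of_mem_right (hP : IsOpen P) (hQ : IsOpen Q) {γ : MForm I M F k}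
    (hγ : γ ∈ localClosedForms I F k (P ∩ Q)) {x : M} (hx : x ∈ Q) :
    b.connect γ x = mextDeriv (b.rightPiece γ) x := by
  rw [connect, MForm.glue_apply_of_mem_right (b.connect_pieces_agree hP hQ hγ) hx,
    MForm.restr_apply_of_mem _ hx]

/-- Off `P ∪ Q`, `connect γ = 0`. [folklore] -/
theorem connect_apply_of_notMem (γ : MForm I M F k) {x : M} (hx : x ∉ P ∪ Q) : b.connect γ x = 0 := by
  rw [mem_union, not_or] at hx
  exact MForm.glue_apply_of_notMem _ _ hx.1 hx.2

/-- `connect` is additive on closed forms. [folklore] -/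
theorem connect_add (hP : IsOpen P) (hQ : IsOpen Q) {γ γ' : MForm I M F k}
    (hγ : γ ∈ localClosedForms I F k (P ∩ Q)) (hγ' : γ' ∈ localClosedForms I F k (P ∩ Q)) :
    b.connect (γ + γ') = b.connect γ + b.connect γ' := by
  funext x
  by_cases hxP : x ∈ P
  · rw [Pi.add_apply, b.connect_apply_of_mem_left _ hxP, b.connect_apply_of_mem_left _ hxP,
      b.connect_apply_of_mem_left _ hxP, leftPiece_add]
    exact mextDeriv_add_apply ((b.leftPiece_mem hP hγ.1).1 x hxP) ((b.leftPiece_mem hP hγ'.1).1 x hxP)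
  · by_cases hxQ : x ∈ Q
    · rw [Pi.add_apply, b.connect_apply_of_mem_right hP hQ (add_mem hγ hγ') hxQ,
        b.connect_apply_of_mem_right hP hQ hγ hxQ, b.connect_apply_of_mem_right hP hQ hγ' hxQ,
        rightPiece_add]
      exact mextDeriv_add_apply ((b.rightPiece_mem hQ hγ.1).1 x hxQ) ((b.rightPiece_mem hQ hγ'.1).1 x hxQ)
    · have h : x ∉ P ∪ Q := fun h ↦ h.elim hxP hxQ
      rw [Pi.add_apply, b.connect_apply_of_notMem _ h, b.connect_apply_of_notMem _ h,
        b.connect_apply_of_notMem _ h, add_zero]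

/-- `connect` commutes with scalars. [folklore] -/
theorem connect_smul (c : ℝ) (γ : MForm I M F k) : b.connect (c • γ) = c • b.connect γ := by
  simp only [connect, leftPiece_smul, rightPiece_smul, mextDeriv_smul, MForm.restr_smul, MForm.glue,
    smul_add]

variable [IsManifold I ∞ M]

/-- `connect γ` is a form on `P ∪ Q` for closed `γ`. [cite: BottTu1982Forms, §I.2 (2.5)] -/
theorem connect_mem_smoothFormsOn (hP : IsOpen P) (hQ : IsOpen Q) {γ : MForm I M F k}
    (hγ : γ ∈ localClosedForms I F k (P ∩ Q)) : b.connect γ ∈ smoothFormsOn I F (P ∪ Q) (k + 1) :=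
  glue_mem_smoothFormsOn hP hQ (restr_mextDeriv_mem hP (b.leftPiece_mem hP hγ.1))
    (restr_mextDeriv_mem hQ (b.rightPiece_mem hQ hγ.1)) (b.connect_pieces_agree hP hQ hγ)

/-- **`connect γ` is closed** (`d ∘ d = 0` on each piece). [cite: BottTu1982Forms, §I.2 (2.5)] -/
theorem connect_mem_localClosedForms (hP : IsOpen P) (hQ : IsOpen Q) {γ : MForm I M F k}
    (hγ : γ ∈ localClosedForms I F k (P ∩ Q)) :
    b.connect γ ∈ localClosedForms I F (k + 1) (P ∪ Q) := by
  refine ⟨b.connect_mem_smoothFormsOn hP hQ hγ, fun x hx ↦ ?_⟩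
  rcases hx with hx | hx
  · have h : ∀ᶠ y in 𝓝 x, b.connect γ y = mextDeriv (b.leftPiece γ) y := by
      filter_upwards [hP.mem_nhds hx] with y hy
      exact b.connect_apply_of_mem_left γ hy
    rw [mextDeriv_congr_of_eventuallyEq h]
    exact mextDeriv_mextDeriv_of_smoothAt (eventually_smoothAt_of_mem hP (b.leftPiece_mem hP hγ.1) hx)
  · have h : ∀ᶠ y in 𝓝 x, b.connect γ y = mextDeriv (b.rightPiece γ) y := by
      filter_upwards [hQ.mem_nhds hx] with y hy
      exact b.connect_apply_of_mem_right hP hQ hγ hy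
    rw [mextDeriv_congr_of_eventuallyEq h]
    exact mextDeriv_mextDeriv_of_smoothAt (eventually_smoothAt_of_mem hQ (b.rightPiece_mem hQ hγ.1) hx)

/-- **The connecting form as a linear map** on closed forms `Z^k(P ∩ Q) → Z^{k+1}(P ∪ Q)`.
[cite: BottTu1982Forms, §I.2 (2.5)] -/
def connectₗ (hP : IsOpen P) (hQ : IsOpen Q) :
    localClosedForms I F k (P ∩ Q) →ₗ[ℝ] localClosedForms I F (k + 1) (P ∪ Q) where
  toFun γ := ⟨b.connect γ.1, b.connect_mem_localClosedForms hP hQ γ.2⟩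
  map_add' γ γ' := Subtype.ext (b.connect_add hP hQ γ.2 γ'.2)
  map_smul' c γ := Subtype.ext (b.connect_smul c γ.1)

/-- Underlying form of `connectₗ`. [folklore] -/
@[simp]
theorem coe_connectₗ (hP : IsOpen P) (hQ : IsOpen Q) (γ : localClosedForms I F k (P ∩ Q)) :
    (b.connectₗ hP hQ γ : MForm I M F (k + 1)) = b.connect γ :=
  rfl

/-- **`connect` of an exact form is exact**: if `γ = d_{P∩Q} β` then
`connect γ = d_{P∪Q} θ` with `θ` glued from `ρ_Q γ - d(ρ_Q β)` on `P` and
`-ρ_P γ + d(ρ_P β)` on `Q` (these agree on `P ∩ Q` since `ρ_P + ρ_Q = 1`; no Leibniz rule is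
needed). Bott–Tu (1982), (2.6)–(2.7) (well-definedness of the coboundary). [cite: BottTu1982Forms, §I.2 (2.6)] -/
theorem connect_mem_localExactForms (hP : IsOpen P) (hQ : IsOpen Q) {γ : MForm I M F k}
    (hγ : γ ∈ localExactForms I F (hP.inter hQ) k) :
    b.connect γ ∈ localExactForms I F (hP.union hQ) (k + 1) := by
  have hγc : γ ∈ localClosedForms I F k (P ∩ Q) := localExactForms_le_localClosedForms _ hγ
  cases k with
  | zero =>
    rw [localExactForms, Submodule.mem_bot] at hγ
    rw [hγ, show (0 : MForm I M F 0) = (0 : ℝ) • (0 : MForm I M F 0) by simp, connect_smul, zero_smul]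
    exact Submodule.zero_mem _
  | succ j =>
    obtain ⟨β, hβγ⟩ := (mem_localExactForms_succ_iff (hP.inter hQ)).1 hγ
    -- the primitives of the two pieces
    have hbP := b.leftPiece_mem hP β.2
    have hbQ := b.rightPiece_mem hQ β.2
    have hlγ := b.leftPiece_mem hP hγc.1
    have hrγ := b.rightPiece_mem hQ hγc.1
    set u : MForm I M F (j + 1) := b.leftPiece γ - (mextDeriv (b.leftPiece (β : MForm I M F j))).restr P with hu
    set v : MForm I M F (j + 1) := b.rightPiece γ - (mextDeriv (b.rightPiece (β : MForm I M F j))).restr Q with hv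
    have hum : u ∈ smoothFormsOn I F P (j + 1) := sub_mem hlγ (restr_mextDeriv_mem hP hbP)
    have hvm : v ∈ smoothFormsOn I F Q (j + 1) := sub_mem hrγ (restr_mextDeriv_mem hQ hbQ)
    -- they agree on `P ∩ Q`
    have huv : ∀ y ∈ P ∩ Q, u y = v y := by
      intro y hy
      have h1 : mextDeriv (b.leftPiece (β : MForm I M F j) - b.rightPiece (β : MForm I M F j)) y =
          mextDeriv (β : MForm I M F j) y := by
        refine mextDeriv_congr_of_eventuallyEq ?_
        filter_upwards [(hP.inter hQ).mem_nhds hy] with z hz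
        exact b.leftPiece_sub_rightPiece_apply _ hz
      have h2 : γ y = mextDeriv (β : MForm I M F j) y := by
        rw [← hβγ, localD_apply_of_mem _ _ hy]
      rw [hu, hv, Pi.sub_apply, Pi.sub_apply, MForm.restr_apply_of_mem _ hy.1,
        MForm.restr_apply_of_mem _ hy.2, sub_eq_sub_iff_sub_eq_sub, b.leftPiece_sub_rightPiece_apply γ hy,
        ← mextDeriv_sub_apply (hbP.1 y hy.1) (hbQ.1 y hy.2), h1, h2]
    set θ : smoothFormsOn I F (P ∪ Q) (j + 1) := ⟨MForm.glue P Q u v, glue_mem_smoothFormsOn hP hQ hum hvm huv⟩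
      with hθ
    refine (mem_localExactForms_succ_iff (hP.union hQ)).2 ⟨θ, funext fun x ↦ ?_⟩
    by_cases hxP : x ∈ P
    · rw [localD_apply_of_mem _ _ (mem_union_left Q hxP), b.connect_apply_of_mem_left γ hxP]
      change mextDeriv (MForm.glue P Q u v) x = _
      rw [mextDeriv_glue_of_mem_left hP u v hxP, hu,
        mextDeriv_sub_apply (hlγ.1 x hxP) ((restr_mextDeriv_mem hP hbP).1 x hxP),
        mextDeriv_restr_apply hP _ hxP,
        mextDeriv_mextDeriv_of_smoothAt (eventually_smoothAt_of_mem hP hbP hxP), sub_zero]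
    · by_cases hxQ : x ∈ Q
      · rw [localD_apply_of_mem _ _ (mem_union_right P hxQ), b.connect_apply_of_mem_right hP hQ hγc hxQ]
        change mextDeriv (MForm.glue P Q u v) x = _
        rw [mextDeriv_glue_of_mem_right hQ huv hxQ, hv,
          mextDeriv_sub_apply (hrγ.1 x hxQ) ((restr_mextDeriv_mem hQ hbQ).1 x hxQ),
          mextDeriv_restr_apply hQ _ hxQ,
          mextDeriv_mextDeriv_of_smoothAt (eventually_smoothAt_of_mem hQ hbQ hxQ), sub_zero]
      · have h : x ∉ P ∪ Q := fun h ↦ h.elim hxP hxQ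
        rw [coe_localD, MForm.restr_apply_of_notMem _ h, b.connect_apply_of_notMem γ h]

end BumpPair

/-! ### The connecting homomorphism -/

section Delta

variable [IsManifold I ∞ M] {P Q : Set M}

/-- **The Mayer–Vietoris connecting homomorphism** `δ : H^k(P ∩ Q) → H^{k+1}(P ∪ Q)` attached
to a bump pair (the class of the connecting form; well defined by
`connect_mem_localExactForms`). Bott–Tu (1982), §I.2; Lee (2013), Thm. 17.20. [cite: BottTu1982Forms, §I.2 (2.5)] -/
def LocalDeRham.delta (hP : IsOpen P) (hQ : IsOpen Q) (b : BumpPair I P Q) :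
    LocalDeRham I F k (hP.inter hQ) →ₗ[ℝ] LocalDeRham I F (k + 1) (hP.union hQ) :=
  Submodule.mapQ _ _ (b.connectₗ hP hQ) fun _ hγ ↦ b.connect_mem_localExactForms hP hQ hγ

/-- `δ` on the class of a closed form is the class of its connecting form. [folklore] -/
theorem LocalDeRham.delta_mk (hP : IsOpen P) (hQ : IsOpen Q) (b : BumpPair I P Q)
    (γ : localClosedForms I F k (P ∩ Q)) :
    LocalDeRham.delta hP hQ b (LocalDeRham.mk (hP.inter hQ) γ) =
      LocalDeRham.mk (hP.union hQ) (b.connectₗ hP hQ γ) :=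
  rfl

/-! ### Exactness at `H^{k+1}(A ∪ B)` (kernel ⊆ image of `δ`), with shrinking -/

/-- **Mayer–Vietoris, kernel ⊆ image of `δ` (relative form).** Let `A ⊇ P`, `B ⊇ Q` be open and
`b` a bump pair for `(P, Q)`. If a closed `(k+1)`-form `θ` on `A ∪ B` is exact on `A`
(`θ|_A = d a`) and on `B` (`θ|_B = d b`), then `γ = (a - b)|_{P ∩ Q}` is closed and
`θ|_{P ∪ Q} - connect γ = d c` with `c` glued from `a|_P - ρ_Q γ` and `b|_Q + ρ_P γ`; hence
`res_{P∪Q} [θ] = δ [γ]`. For `P = A`, `Q = B` this is the exactness of the Mayer–Vietoris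
sequence at `H^{k+1}(A ∪ B)`. Bott–Tu (1982), Prop. 2.3 and (2.5)–(2.7); Lee (2013),
Thm. 17.20. [cite: BottTu1982Forms, Prop. 2.3] -/
theorem LocalDeRham.exists_delta_eq_res {A B : Set M} (hA : IsOpen A) (hB : IsOpen B) (hP : IsOpen P)
    (hQ : IsOpen Q) (hPA : P ⊆ A) (hQB : Q ⊆ B) (b : BumpPair I P Q)
    {c : LocalDeRham I F (k + 1) (hA.union hB)}
    (hcA : LocalDeRham.res I F (k + 1) hA (hA.union hB) subset_union_left c = 0)
    (hcB : LocalDeRham.res I F (k + 1) hB (hA.union hB) subset_union_right c = 0) :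
    ∃ c' : LocalDeRham I F k (hA.inter hB),
      LocalDeRham.res I F (k + 1) (hP.union hQ) (hA.union hB) (union_subset_union hPA hQB) c =
        LocalDeRham.delta hP hQ b
          (LocalDeRham.res I F k (hP.inter hQ) (hA.inter hB) (inter_subset_inter hPA hQB) c') := by
  obtain ⟨⟨θ, hθ⟩, rfl⟩ := LocalDeRham.mk_surjective _ c
  -- primitives on `A` and on `B`
  rw [LocalDeRham.res_mk, LocalDeRham.mk_eq_zero_iff, coe_restrictClosedₗ] at hcA hcB
  obtain ⟨a, ha⟩ := (mem_localExactForms_succ_iff hA).1 hcA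
  obtain ⟨bb, hb⟩ := (mem_localExactForms_succ_iff hB).1 hcB
  have hda : ∀ y ∈ A, mextDeriv (a : MForm I M F k) y = θ y := fun y hy ↦ by
    rw [← localD_apply_of_mem hA a hy, ha, MForm.restr_apply_of_mem _ hy]
  have hdb : ∀ y ∈ B, mextDeriv (bb : MForm I M F k) y = θ y := fun y hy ↦ by
    rw [← localD_apply_of_mem hB bb hy, hb, MForm.restr_apply_of_mem _ hy]
  -- the closed form `a - b` on `A ∩ B`
  have hγ' : ((a : MForm I M F k) - bb).restr (A ∩ B) ∈ localClosedForms I F k (A ∩ B) := by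
    refine ⟨⟨fun y hy ↦ (MForm.smoothAt_restr_iff (hA.inter hB) _ hy).2
        ((a.2.1 y hy.1).sub (bb.2.1 y hy.2)), fun y hy ↦ MForm.restr_apply_of_notMem _ hy⟩,
      fun y hy ↦ ?_⟩
    rw [mextDeriv_restr_apply (hA.inter hB) _ hy, mextDeriv_sub_apply (a.2.1 y hy.1) (bb.2.1 y hy.2),
      hda y hy.1, hdb y hy.2, sub_self]
  refine ⟨LocalDeRham.mk _ ⟨_, hγ'⟩, ?_⟩
  -- its restriction `γ` to `P ∩ Q`
  set γ : MForm I M F k := (((a : MForm I M F k) - bb).restr (A ∩ B)).restr (P ∩ Q) with hγdef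
  have hγeq : γ = ((a : MForm I M F k) - bb).restr (P ∩ Q) :=
    MForm.restr_restr_of_subset (inter_subset_inter hPA hQB) _
  have hγ : γ ∈ localClosedForms I F k (P ∩ Q) :=
    restr_mem_localClosedForms (hP.inter hQ) (inter_subset_inter hPA hQB) hγ'
  have hγapply : ∀ y ∈ P ∩ Q, γ y = (a : MForm I M F k) y - (bb : MForm I M F k) y := fun y hy ↦ by
    rw [hγeq, MForm.restr_apply_of_mem _ hy]; rfl
  rw [LocalDeRham.res_mk, LocalDeRham.res_mk, LocalDeRham.delta_mk, LocalDeRham.mk_eq_mk_iff]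
  change θ.restr (P ∪ Q) - b.connect γ ∈ localExactForms I F (hP.union hQ) (k + 1)
  -- the primitive of `θ|_{P ∪ Q} - connect γ`
  have hlγ := b.leftPiece_mem hP hγ.1
  have hrγ := b.rightPiece_mem hQ hγ.1
  set u : MForm I M F k := (a : MForm I M F k).restr P - b.leftPiece γ with hu
  set v : MForm I M F k := (bb : MForm I M F k).restr Q - b.rightPiece γ with hv
  have hum : u ∈ smoothFormsOn I F P k := sub_mem (restr_mem_smoothFormsOn hP hPA a.2) hlγ
  have hvm : v ∈ smoothFormsOn I F Q k := sub_mem (restr_mem_smoothFormsOn hQ hQB bb.2) hrγ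
  have huv : ∀ y ∈ P ∩ Q, u y = v y := by
    intro y hy
    rw [hu, hv, Pi.sub_apply, Pi.sub_apply, MForm.restr_apply_of_mem _ hy.1,
      MForm.restr_apply_of_mem _ hy.2, sub_eq_sub_iff_sub_eq_sub, b.leftPiece_sub_rightPiece_apply γ hy,
      hγapply y hy]
  set cc : smoothFormsOn I F (P ∪ Q) k := ⟨MForm.glue P Q u v, glue_mem_smoothFormsOn hP hQ hum hvm huv⟩
    with hcc
  refine (mem_localExactForms_succ_iff (hP.union hQ)).2 ⟨cc, funext fun x ↦ ?_⟩
  by_cases hxP : x ∈ P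
  · rw [localD_apply_of_mem _ _ (mem_union_left Q hxP), Pi.sub_apply, MForm.restr_apply_of_mem _ (mem_union_left Q hxP),
      b.connect_apply_of_mem_left γ hxP]
    change mextDeriv (MForm.glue P Q u v) x = _
    rw [mextDeriv_glue_of_mem_left hP u v hxP, hu,
      mextDeriv_sub_apply ((restr_mem_smoothFormsOn hP hPA a.2).1 x hxP) (hlγ.1 x hxP),
      mextDeriv_restr_apply hP _ hxP, hda x (hPA hxP)]
  · by_cases hxQ : x ∈ Q
    · rw [localD_apply_of_mem _ _ (mem_union_right P hxQ), Pi.sub_apply, MForm.restr_apply_of_mem _ (mem_union_right P hxQ),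
        b.connect_apply_of_mem_right hP hQ hγ hxQ]
      change mextDeriv (MForm.glue P Q u v) x = _
      rw [mextDeriv_glue_of_mem_right hQ huv hxQ, hv,
        mextDeriv_sub_apply ((restr_mem_smoothFormsOn hQ hQB bb.2).1 x hxQ) (hrγ.1 x hxQ),
        mextDeriv_restr_apply hQ _ hxQ, hdb x (hQB hxQ)]
    · have h : x ∉ P ∪ Q := fun h ↦ h.elim hxP hxQ
      rw [coe_localD, MForm.restr_apply_of_notMem _ h, Pi.sub_apply, MForm.restr_apply_of_notMem _ h,
        b.connect_apply_of_notMem γ h, sub_zero]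

/-! ### Degree `0`: a class that dies on `A` and on `B` is zero -/

omit [IsManifold I ∞ M] in
/-- A form on `A ∪ B` whose restrictions to `A` and to `B` vanish is zero. [folklore] -/
theorem eq_zero_of_restr_eq_zero {A B : Set M} {θ : MForm I M F k} (hθ : θ ∈ smoothFormsOn I F (A ∪ B) k)
    (hA : θ.restr A = 0) (hB : θ.restr B = 0) : θ = 0 := by
  funext x
  by_cases hxA : x ∈ A
  · rw [← MForm.restr_apply_of_mem θ hxA, hA]
  · by_cases hxB : x ∈ B
    · rw [← MForm.restr_apply_of_mem θ hxB, hB]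
    · exact hθ.2 x fun h ↦ h.elim hxA hxB

/-- **Mayer–Vietoris in degree `0`**: `H⁰(A ∪ B) → H⁰(A) ⊕ H⁰(B)` is injective (exact
`0`-forms are `0`). Bott–Tu (1982), Prop. 2.3; Lee (2013), Thm. 17.20. [cite: BottTu1982Forms, Prop. 2.3] -/
theorem LocalDeRham.eq_zero_of_res_eq_zero {A B : Set M} (hA : IsOpen A) (hB : IsOpen B)
    {c : LocalDeRham I F 0 (hA.union hB)}
    (hcA : LocalDeRham.res I F 0 hA (hA.union hB) subset_union_left c = 0)
    (hcB : LocalDeRham.res I F 0 hB (hA.union hB) subset_union_right c = 0) : c = 0 := by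
  obtain ⟨⟨θ, hθ⟩, rfl⟩ := LocalDeRham.mk_surjective _ c
  rw [LocalDeRham.res_mk, LocalDeRham.mk_eq_zero_iff, coe_restrictClosedₗ, localExactForms,
    Submodule.mem_bot] at hcA hcB
  have h0 : θ = 0 := eq_zero_of_restr_eq_zero hθ.1 hcA hcB
  have : (⟨θ, hθ⟩ : localClosedForms I F 0 (A ∪ B)) = 0 := Subtype.ext h0
  rw [this, _root_.map_zero]

end Delta

end Literature.Geometry.Kaehler
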